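import Summits.CriticalPhenomena.PercolationContinuityZ3.Theorems.PercNearOneGluingNoHeavyLowerTailSahiMixtureChainMoments
import HarnessLib

/-!
# Monotone mixtures of product measures: the weight, its moments, and Sahi positivity at every order

Support file of the one-cut programme (crux `NoHeavyLowerTail`, stmt-CriticalPhenomena-4575; cell `prim-masterthm`, seat P3, gen 15;
`run/shared/lean/prim/prim-masterthm/prim-masterthm-p3/HIERARCHY.md` §23; memo
`run/shared/lean/prim/prim-masterthm/FROM-prim-masterthm-p3-g15-MONOTONE-MIXTURES.md`).  Companion of the definition-free
`…SahiMixtureChainMoments.lean`, which proves the theorems from the CHAIN-MOMENT hypothesis; this file supplies the concrete law and verifies the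
hypothesis for it.

THE CLASS.  A **monotone mixture of product measures** (MMP) on `L` levels and a finite set `ι` of bits is the weight
`(l, ε) ↦ w_l · Π_i (y_{l,i} if ε_i else 1 − y_{l,i})` on `Fin L × (ι → Bool)` (`mixProdWeight w y`), with level weights `w_l ≥ 0`, `Σ w = 1`, and bit
probabilities `y_{l,i} ∈ [0,1]` nondecreasing in the level `l` for every bit `i` (co-monotone).  The events are the bits `A_i = {ε_i}` (`bitEv i`).
Equivalently: events conditionally independent given a latent level with co-monotone conditional probabilities — one-factor threshold models,
de Finetti exchangeable laws (`y_{l,i} = p_l`), nested events (`y ∈ {0,1}`).  By the Karlin–Rinott composition theorem these weights satisfy the FKG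
lattice condition; the results below are thus the case "distinct coordinate events of a monotone mixture of product measures" of Sahi's
Conjecture 5, at every order.

CONTENTS (everything PROVED, standard axioms): `mixProdWeight`, `bitEv`, `ind_bitEv`, `mixProdWeight_nonneg`, `sum_prod_bern_pin` (summing a
product weight with pinned bits), `sum_mixProdWeight`, **`ex_mixProdWeight_prod_ind`** (conditional independence: `E[Π_r 1_{A_{e r}}] = Σ_l w_l Π_r y_{l,e r}`
for distinct bits), **`sahiE_nonneg_of_monotoneMixture`** (every `m`, every `m` distinct bits: `E_m ≥ 0`), `sahiE_nonneg_of_monotoneMixture_all`,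
`sahiE_nonneg_of_deFinetti`, **`sahiE_orCoin_all_nonneg_of_monotoneMixture`** (OR-ing an independent coin into all members keeps `E_m ≥ 0`, every `m`).
HONEST FRAMING: nothing here asserts (M⁺-k) or `C_k` for `k ≥ 3`; general increasing events of these laws and overlapping intersections of the bits
are not covered. [this work]
-/

noncomputable section

open scoped Classical

namespace Summit.CriticalPhenomena.PercolationContinuityZ3.Theorems

open Finset Function
open Literature.Combinatorics.Sahi2008
open Literature.Probability.Percolation.DecisionTree (ind ind_of_mem ind_of_not_mem ind_nonneg)

namespace SahiMixture

section MMP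

variable {L : ℕ} {ι : Type*} [Fintype ι] [DecidableEq ι]

/-- The weight of a **mixture of product measures**: level `l` with weight `w l`, then independent bits with probabilities `y l i`.
(Monotonicity of `y` in `l` is a hypothesis of the theorems, not part of the definition.) [this work] -/
def mixProdWeight (w : Fin L → ℝ) (y : Fin L → ι → ℝ) : Fin L × (ι → Bool) → ℝ :=
  fun x => w x.1 * ∏ i, (bif x.2 i then y x.1 i else 1 - y x.1 i)

/-- The event "bit `i` is on". [this work] -/
def bitEv (i : ι) : Set (Fin L × (ι → Bool)) := {x | x.2 i = true}

omit [Fintype ι] [DecidableEq ι] in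
/-- The indicator of a bit event. [this work] -/
theorem ind_bitEv (i : ι) (x : Fin L × (ι → Bool)) : ind (bitEv i) x = bif x.2 i then 1 else 0 := by
  by_cases hx : x.2 i = true
  · rw [ind_of_mem (show x ∈ bitEv i from hx), hx]; rfl
  · rw [ind_of_not_mem (show x ∉ bitEv i from hx)]
    rw [Bool.not_eq_true] at hx
    rw [hx]; rfl

omit [DecidableEq ι] in
/-- The mixture weight is nonnegative when `w ≥ 0` and `0 ≤ y ≤ 1`. [this work] -/
theorem mixProdWeight_nonneg {w : Fin L → ℝ} (hw0 : ∀ l, 0 ≤ w l) {y : Fin L → ι → ℝ} (hy0 : ∀ l i, 0 ≤ y l i)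
    (hy1 : ∀ l i, y l i ≤ 1) (x : Fin L × (ι → Bool)) : 0 ≤ mixProdWeight w y x := by
  unfold mixProdWeight
  refine mul_nonneg (hw0 _) (Finset.prod_nonneg fun i _ => ?_)
  cases x.2 i
  · simpa using sub_nonneg.2 (hy1 x.1 i)
  · simpa using hy0 x.1 i

/-- Summing a product weight over all bit configurations with the bits of `S` pinned to "on":
`Σ_ε Π_i (z_i if ε_i else 1 − z_i) · Π_{i∈S} [ε_i] = Π_{i∈S} z_i`. [this work] -/
theorem sum_prod_bern_pin (z : ι → ℝ) (S : Finset ι) :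
    ∑ ε : ι → Bool, (∏ i, (bif ε i then z i else 1 - z i)) * ∏ i ∈ S, (bif ε i then (1 : ℝ) else 0) = ∏ i ∈ S, z i := by
  have e1 : ∀ ε : ι → Bool, (∏ i, (bif ε i then z i else 1 - z i)) * ∏ i ∈ S, (bif ε i then (1 : ℝ) else 0)
      = ∏ i, ((bif ε i then z i else 1 - z i) * (if i ∈ S then (bif ε i then (1 : ℝ) else 0) else 1)) := by
    intro ε
    rw [← Fintype.prod_ite_mem S (fun i => (bif ε i then (1 : ℝ) else 0)), ← Finset.prod_mul_distrib]
  simp_rw [e1]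
  rw [← Fintype.prod_sum (fun i b => (bif b then z i else 1 - z i) * (if i ∈ S then (bif b then (1 : ℝ) else 0) else 1))]
  rw [← Fintype.prod_ite_mem S z]
  refine Finset.prod_congr rfl fun i _ => ?_
  simp only [Fintype.sum_bool, cond_true, cond_false]
  split_ifs <;> ring

/-- The mixture weight has total mass `Σ_l w_l`. [this work] -/
theorem sum_mixProdWeight (w : Fin L → ℝ) (y : Fin L → ι → ℝ) : ∑ x, mixProdWeight w y x = ∑ l, w l := by
  unfold mixProdWeight
  rw [Fintype.sum_prod_type]
  refine Finset.sum_congr rfl fun l _ => ?_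
  have h := sum_prod_bern_pin (y l) (∅ : Finset ι)
  simp only [Finset.prod_empty, mul_one] at h
  simp only [← Finset.mul_sum, h, mul_one]

/-- **Conditional independence**: the moment of a product of DISTINCT bit indicators under the mixture is the `w`-mixture over levels of the product
of the bit probabilities — the chain-moment hypothesis of `…SahiMixtureChainMoments`. [this work] -/
theorem ex_mixProdWeight_prod_ind (w : Fin L → ℝ) (y : Fin L → ι → ℝ) {k : ℕ} (e : Fin k → ι) (he : Function.Injective e) :
    ex (mixProdWeight w y) (∏ r, ind (bitEv (e r))) = ∑ l, w l * ∏ r, y l (e r) := by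
  rw [ex_def, Fintype.sum_prod_type]
  refine Finset.sum_congr rfl fun l _ => ?_
  have hS : ∀ ε : ι → Bool, (∏ r, ind (bitEv (L := L) (e r))) (l, ε) = ∏ i ∈ Finset.univ.image e, (bif ε i then (1 : ℝ) else 0) := by
    intro ε
    rw [Finset.prod_apply, Finset.prod_image fun a _ b _ hab => he hab]
    exact Finset.prod_congr rfl fun r _ => ind_bitEv _ _
  have hy : ∏ r, y l (e r) = ∏ i ∈ Finset.univ.image e, y l i := by
    rw [Finset.prod_image fun a _ b _ hab => he hab]
  simp_rw [hS]
  unfold mixProdWeight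
  simp_rw [mul_assoc]
  rw [← Finset.mul_sum, sum_prod_bern_pin (y l) (Finset.univ.image e), hy]

/-- **Sahi positivity of every order for monotone mixtures of product measures.**  Level weights `w ≥ 0` of mass `1`, bit probabilities `y_{l,i} ≥ 0`
nondecreasing in the level `l` for every bit `i` (the bound `y ≤ 1`, which makes the weight a probability, is not needed for the inequality); then for
every `m` and every `m`-tuple of DISTINCT bits, `E_m(1_{A_{e 0}},…,1_{A_{e(m−1)}}) ≥ 0`. [this work] -/
theorem sahiE_nonneg_of_monotoneMixture (w : Fin L → ℝ) (hw0 : ∀ l, 0 ≤ w l) (hw1 : ∑ l, w l = 1)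
    (y : Fin L → ι → ℝ) (hy0 : ∀ l i, 0 ≤ y l i) (hmono : ∀ i, Monotone (fun l => y l i))
    {m : ℕ} (e : Fin m → ι) (he : Function.Injective e) :
    0 ≤ sahiE (mixProdWeight w y) m (fun j => ind (bitEv (e j))) :=
  sahiE_nonneg_of_chainMoments (mixProdWeight w y) (fun j => bitEv (e j)) w hw0 hw1 (fun l j => y l (e j))
    (fun l j => hy0 l (e j)) (fun j => hmono (e j))
    fun _ e' he' => ex_mixProdWeight_prod_ind w y (e ∘ e') (he.comp he')

/-- The whole family: for the `n` bits of a monotone mixture of product measures, `E_n(1_{A_0},…,1_{A_{n−1}}) ≥ 0`, for every `n`. [this work] -/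
theorem sahiE_nonneg_of_monotoneMixture_all {n : ℕ} (w : Fin L → ℝ) (hw0 : ∀ l, 0 ≤ w l) (hw1 : ∑ l, w l = 1)
    (y : Fin L → Fin n → ℝ) (hy0 : ∀ l i, 0 ≤ y l i) (hmono : ∀ i, Monotone (fun l => y l i)) :
    0 ≤ sahiE (mixProdWeight w y) n (fun j => ind (bitEv j)) :=
  sahiE_nonneg_of_monotoneMixture w hw0 hw1 y hy0 hmono id injective_id

/-- **de Finetti exchangeable laws** (mixtures of i.i.d. bits, `y_{l,i} = p_l`, levels sorted so that `p` is nondecreasing): `E_m ≥ 0` for every `m`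
and every `m` distinct members. [this work] -/
theorem sahiE_nonneg_of_deFinetti (w : Fin L → ℝ) (hw0 : ∀ l, 0 ≤ w l) (hw1 : ∑ l, w l = 1)
    (p : Fin L → ℝ) (hp0 : ∀ l, 0 ≤ p l) (hmono : Monotone p) {m : ℕ} (e : Fin m → ι) (he : Function.Injective e) :
    0 ≤ sahiE (mixProdWeight w (fun l (_ : ι) => p l)) m (fun j => ind (bitEv (e j))) :=
  sahiE_nonneg_of_monotoneMixture w hw0 hw1 _ (fun l _ => hp0 l) (fun _ => hmono) e he

/-- **The all-members OR-coin cell is nonnegative at every order** for a monotone mixture of product measures with `0 ≤ y ≤ 1`: for an independent coin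
of bias `h ∈ [0,1]`, every `m` and every `m` distinct bits, `E_m(μ ⊗ coin(h); 1_{A_{e 0} ∪ H},…,1_{A_{e(m−1)} ∪ H}) ≥ 0` — the value form of the TOP
rung of the H-MIX ladder on this class, uniformly in `m`. [this work] -/
theorem sahiE_orCoin_all_nonneg_of_monotoneMixture (w : Fin L → ℝ) (hw0 : ∀ l, 0 ≤ w l) (hw1 : ∑ l, w l = 1)
    (y : Fin L → ι → ℝ) (hy0 : ∀ l i, 0 ≤ y l i) (hy1 : ∀ l i, y l i ≤ 1) (hmono : ∀ i, Monotone (fun l => y l i))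
    {h : ℝ} (h0 : 0 ≤ h) (h1 : h ≤ 1) {m : ℕ} (e : Fin m → ι) (he : Function.Injective e) :
    0 ≤ sahiE (coinWeight (mixProdWeight w y) h) m (fun j => ind (orCoin (bitEv (e j)) true)) := by
  have hμ1 : ∑ x, mixProdWeight w y x = 1 := by rw [sum_mixProdWeight, hw1]
  exact sahiE_orCoin_all_nonneg_of_chainMoments (mixProdWeight w y) hμ1 (fun j => bitEv (e j)) w hw0 hw1 (fun l j => y l (e j))
    (fun l j => hy0 l (e j)) (fun l j => hy1 l (e j)) (fun j => hmono (e j))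
    (fun _ e' he' => ex_mixProdWeight_prod_ind w y (e ∘ e') (he.comp he')) h0 h1 id injective_id

end MMP

end SahiMixture

end Summit.CriticalPhenomena.PercolationContinuityZ3.Theorems

end
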